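import Literature.GroupTheory.CombinatorialGroupTheory.SignedHurwitzStabilisation
import Literature.GroupTheory.CombinatorialGroupTheory.SignedHurwitzTravel
import Literature.GroupTheory.CombinatorialGroupTheory.SignedHurwitzExchange
import HarnessLib

/-!
# Bookkeeping along `Reach`: signed Hurwitz moves and stabilisation pairs keep `4g` letters,
# `2g` positive letters and non-zero classes

Companion to `SignedHurwitzStabilisation.lean` (`Reach` = signed Hurwitz moves for `stdSymp ℤ` at
the current genus + stabilisation-pair moves `StabStep`).  Three proved invariance lemmas of the
purely algebraic calculus, nothing asserted:

* `Reach.forall_ne_zero` — if all classes of `l` are non-zero, so are all classes of every word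
  reachable from it (Hurwitz moves: the pairing is alternating, `HurwitzStep.ne_zero`; a
  stabilisation block has the letters `e + c`, `f` with a coordinate `1` in the new pair, and `embed`
  is injective);
* `Reach.length_eq_four_mul` — `4g` letters at genus `g` persist (`+4` letters, `+1` genus per block);
* `Reach.length_filter_eq_two_mul` — `2g` positive letters persist (`+2` per block).

Consumer: the composition of crux `ConvexBisection.AcyclicBisectionExists` (stmt-SmoothPoincare4-10508,
line `modp-braid-orbits`), which transports the counts of a model word to the sorted word it realises.
-/

noncomputable section

namespace Literature.GroupTheory.CombinatorialGroupTheory.SignedHurwitz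

/-- The letters of the stabilisation block are non-zero (they have a coordinate `1` in the new
pair). [folklore] -/
theorem stabBlock_forall_ne_zero (n : ℕ) (c : Fin n ⊕ Fin n → ℤ) : ∀ x ∈ stabBlock n c, x.1 ≠ 0 := by
  intro x hx
  simp only [stabBlock, List.mem_cons, List.not_mem_nil, or_false] at hx
  have hE : newE n + embed n c ≠ 0 := fun h => by
    have := congrFun h (Sum.inl (Fin.last n))
    simp [newE] at this
  have hF : newF n ≠ 0 := fun h => by
    have := congrFun h (Sum.inr (Fin.last n))
    simp [newF] at this
  rcases hx with rfl | rfl | rfl | rfl <;> assumption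

/-- Embedded letters of a word with non-zero classes are non-zero. [folklore] -/
theorem mapWord_embed_forall_ne_zero (n : ℕ) {w : IntWord n} (hw : ∀ x ∈ w, x.1 ≠ 0) :
    ∀ x ∈ mapWord (embed n) w, x.1 ≠ 0 := by
  intro x hx
  obtain ⟨y, hy, rfl⟩ := List.mem_map.1 hx
  intro h0
  exact hw y hy (embed_injective n (h0.trans (embed_zero n).symm))

/-- **Reachability kills no class**: signed Hurwitz moves (alternating pairing) and
stabilisation-pair moves preserve "all classes non-zero". [folklore] -/
theorem Reach.forall_ne_zero {g : ℕ} {l : IntWord g} {g' : ℕ} {l' : IntWord g'} (h : Reach g l g' l')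
    (hl : ∀ x ∈ l, x.1 ≠ 0) : ∀ x ∈ l', x.1 ≠ 0 := by
  induction h with
  | refl => exact hl
  | hurwitz _ hst ih => exact hst.ne_zero (stdSymp_int_self _) ih
  | stab _ hst ih =>
    obtain ⟨A, B, c, -, rfl, rfl⟩ := hst
    have hA : ∀ x ∈ A, x.1 ≠ 0 := fun x hx => ih x (List.mem_append_left _ hx)
    have hB : ∀ x ∈ B, x.1 ≠ 0 := fun x hx => ih x (List.mem_append_right _ hx)
    intro x hx
    simp only [List.mem_append] at hx
    rcases hx with (hx | hx) | hx
    · exact mapWord_embed_forall_ne_zero _ hA x hx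
    · exact stabBlock_forall_ne_zero _ c x hx
    · exact mapWord_embed_forall_ne_zero _ hB x hx

/-- **Reachability keeps `4g` letters at genus `g`.** [folklore] -/
theorem Reach.length_eq_four_mul {g : ℕ} {l : IntWord g} {g' : ℕ} {l' : IntWord g'} (h : Reach g l g' l')
    (hl : l.length = 4 * g) : l'.length = 4 * g' := by
  induction h with
  | refl => exact hl
  | hurwitz _ hst ih => rw [← ih]; exact hst.length_eq
  | stab _ hst ih =>
    obtain ⟨A, B, c, -, rfl, rfl⟩ := hst
    simp only [List.length_append, length_mapWord, stabBlock, List.length_cons, List.length_nil] at ih ⊢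
    omega

/-- **Reachability keeps `2g` positive letters at genus `g`.** [folklore] -/
theorem Reach.length_filter_eq_two_mul {g : ℕ} {l : IntWord g} {g' : ℕ} {l' : IntWord g'}
    (h : Reach g l g' l') (hl : (l.filter (·.2)).length = 2 * g) :
    (l'.filter (·.2)).length = 2 * g' := by
  induction h with
  | refl => exact hl
  | hurwitz _ hst ih => rw [← ih]; exact hst.length_filter_eq
  | stab _ hst ih =>
    obtain ⟨A, B, c, -, rfl, rfl⟩ := hst
    simp only [List.filter_append, List.length_append, length_filter_mapWord] at ih ⊢
    have : ((stabBlock _ c).filter (·.2)).length = 2 := by simp [stabBlock]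
    omega

end Literature.GroupTheory.CombinatorialGroupTheory.SignedHurwitz
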